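import Literature.AlgebraicGeometry.Motives.RelativeDimensionPieces
import HarnessLib

/-!
# Relative dimension descends along a surjective morphism of relative dimension `0` of the source

Layer `Literature/AlgebraicGeometry/Morphisms`, namespace `Literature.AlgebraicGeometry.Morphisms`.  THEOREMS ONLY.
Cell hodgecm-mathlib (D-0151), Hecke-link socket (B): the field `relDim : (A′/K₀).IsOfRelDim g` of the quotient triple
`Q : PolarizedAbelianSchemeWithLevel` (★ `isOfRelDim_iff : A.IsOfRelDim g ↔ SmoothOfRelativeDimension g A.X.hom`), from the
étale surjective quotient map `ψ : A′ → A′/K₀` (★ `IsGeometricQuotient.etale_of_free`) and `A′ → S` smooth of relative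
dimension `g`; companion of ★ `Morphisms/SmoothOfFlatSurjectiveSmoothSource` (p742337, smoothness of `A′/K₀ → S`).  The tree
descends the relative dimension along BASE change only (★ `Limits/RelativeDimensionDescent`); this is the SOURCE side
([Grothendieck1967] EGA IV₄ 17.7.7 with 17.10.2: relative dimension of a composite; [GortzWedhorn2020] Prop. 6.15 (1)):

* **`smoothOfRelativeDimension_of_comp_surjective`** — `ψ : A → Q` surjective and smooth of relative dimension `0`
  (e.g. étale), `g : Q → S` smooth, `ψ ≫ g` smooth of relative dimension `n` ⟹ `g` smooth of relative dimension `n`: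
  the relative dimension of the smooth `g` is locally constant (★ `exists_opens_smoothOfRelativeDimension_of_smooth`); on
  an open `V` where it is `m`, `ψ⁻¹V → S` is smooth of relative dimension `0 + m` and of relative dimension `n`, and
  `ψ⁻¹V ≠ ∅` (`ψ` onto), so `m = n` (★ `AbelianVarietyProofs.eq_of_smoothOfRelativeDimension`); conclude Zariski-locally
  on `Q`;
* `smoothOfRelativeDimension_of_comp_surjective_of_etale` — the étale spelling.

## References

* [Grothendieck1967] A. Grothendieck, *EGA IV₄* (Publ. Math. IHÉS 32, 1967), Prop. 17.7.7 and 17.10.2.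
* [GortzWedhorn2020] U. Görtz, T. Wedhorn, *Algebraic Geometry I*, 2nd ed. (2020), Prop. 6.15 (1) (p. 157).
-/

noncomputable section

open CategoryTheory CategoryTheory.Limits AlgebraicGeometry TopologicalSpace

universe u

namespace Literature.AlgebraicGeometry.Morphisms

open Literature.AlgebraicGeometry.Motives

/-- **Relative dimension descends along a surjective morphism of relative dimension `0` of the source**: `ψ : A → Q`
surjective and smooth of relative dimension `0`, `g : Q → S` smooth with `ψ ≫ g` smooth of relative dimension `n` ⟹ `g`
is smooth of relative dimension `n`. [cite: Grothendieck1967, Prop. 17.7.7 and 17.10.2] [cite: GortzWedhorn2020, Prop. 6.15 (1) (p. 157)] -/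
theorem smoothOfRelativeDimension_of_comp_surjective {A Q S : Scheme.{u}} (ψ : A ⟶ Q) (g : Q ⟶ S)
    [SmoothOfRelativeDimension 0 ψ] [Surjective ψ] [Smooth g] (n : ℕ)
    [h : SmoothOfRelativeDimension n (ψ ≫ g)] : SmoothOfRelativeDimension n g := by
  have key : ∀ q : Q, ∃ V : Q.Opens, q ∈ V ∧ SmoothOfRelativeDimension n (V.ι ≫ g) := by
    intro q
    obtain ⟨V, m, hqV, hV⟩ := exists_opens_smoothOfRelativeDimension_of_smooth g q
    haveI := hV
    -- `ψ⁻¹ V → V → S` has relative dimension `0 + m` …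
    haveI : SmoothOfRelativeDimension 0 (ψ ∣_ V) := IsZariskiLocalAtTarget.restrict (P := @SmoothOfRelativeDimension 0) inferInstance V
    have h1 : SmoothOfRelativeDimension (0 + m) ((ψ ∣_ V) ≫ V.ι ≫ g) := inferInstance
    rw [← Category.assoc, morphismRestrict_ι, Category.assoc] at h1
    -- … and relative dimension `n`
    have h2 : SmoothOfRelativeDimension n ((ψ ⁻¹ᵁ V).ι ≫ ψ ≫ g) := IsZariskiLocalAtSource.comp h _
    -- `ψ⁻¹ V ≠ ∅`
    obtain ⟨a, ha⟩ := ψ.surjective q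
    haveI : Nonempty (↑(ψ ⁻¹ᵁ V) : Scheme.{u}) := ⟨⟨a, show ψ.base a ∈ V by rw [ha]; exact hqV⟩⟩
    have hmn : 0 + m = n := AbelianVarietyProofs.eq_of_smoothOfRelativeDimension _ h1 h2
    rw [Nat.zero_add] at hmn
    exact ⟨V, hqV, hmn ▸ hV⟩
  choose V hqV hV using key
  have hcov : iSup V = ⊤ := top_le_iff.mp fun x _ => Opens.mem_iSup.mpr ⟨x, hqV x⟩
  exact IsZariskiLocalAtSource.of_iSup_eq_top (P := @SmoothOfRelativeDimension n) V hcov hV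

/-- **Étale spelling**: `ψ : A → Q` étale surjective, `g : Q → S` smooth, `ψ ≫ g` smooth of relative dimension `n` ⟹ `g`
smooth of relative dimension `n`. [cite: Grothendieck1967, Prop. 17.7.7 and 17.10.2] -/
theorem smoothOfRelativeDimension_of_comp_surjective_of_etale {A Q S : Scheme.{u}} (ψ : A ⟶ Q) (g : Q ⟶ S)
    [Etale ψ] [Surjective ψ] [Smooth g] (n : ℕ) [SmoothOfRelativeDimension n (ψ ≫ g)] :
    SmoothOfRelativeDimension n g :=
  smoothOfRelativeDimension_of_comp_surjective ψ g n

/-- The same with the composite given as a named morphism `f = ψ ≫ g` (the shape of an `Over`-triangle `Over.w`).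
[cite: Grothendieck1967, Prop. 17.7.7 and 17.10.2] -/
theorem smoothOfRelativeDimension_of_comp_eq_of_etale {A Q S : Scheme.{u}} (ψ : A ⟶ Q) (g : Q ⟶ S) (f : A ⟶ S)
    (hf : ψ ≫ g = f) [Etale ψ] [Surjective ψ] [Smooth g] (n : ℕ) [SmoothOfRelativeDimension n f] :
    SmoothOfRelativeDimension n g := by
  subst hf
  exact smoothOfRelativeDimension_of_comp_surjective ψ g n

end Literature.AlgebraicGeometry.Morphisms

end
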